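import Literature.RepresentationTheory.IntertwiningMapBaseChange
import Mathlib.RepresentationTheory.Invariants
import Mathlib.RingTheory.Flat.Equalizer
import Mathlib.LinearAlgebra.Dimension.Localization
import Mathlib.LinearAlgebra.TensorProduct.Pi
import HarnessLib

/-!
# Invariants do not grow under flat extension of scalars: `(K ⊗_k V)^H = K ⊗_k V^H`, and the
# bookkeeping `(V × W)^H = V^H × W^H`, `k^H = k`

Topic `RepresentationTheory`; namespace `Literature.RepresentationTheory`.  Theorems and two auxiliary
definitions with bodies (a linear map and a linear equivalence); Mathlib + the tree's
`IntertwiningMapBaseChange` (`repBaseChange K ρ : Representation K G (K ⊗[k] V)`, `g ↦ 1 ⊗ ρ(g)`) only;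
no named fact, no `sorry`, no instance.

Let `k → K` be commutative rings, `G` a group, `ρ : G → GL(V)` a representation on a `k`-module and
`H ≤ G` a FINITE subgroup.  The fixed module `V^H = invariants (ρ|_H)` is the kernel of the single linear
map `Φ : V → V^H`, `v ↦ (ρ(h)v − v)_{h ∈ H}` (`invariantsCond`, `ker_invariantsCond`), and the fixed module
of the extended representation `ρ_K` on `K ⊗_k V` is the kernel of `1 ⊗ Φ` (the finite product commutes
with `K ⊗_k −`, Mathlib `TensorProduct.piRight`).  Hence, when `K` is FLAT over `k`
(Bourbaki, *Algèbre commutative* I §2 no. 3 Prop. 1 / no. 10: a flat functor preserves kernels; Mathlib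
`LinearMap.tensorKerEquiv`):

* **`invariantsBaseChangeEquiv K ρ H : K ⊗[k] V^H ≃ₗ[K] (K ⊗[k] V)^H`**;
* **`finrank_invariants_repBaseChange`**: `finrank_K (K ⊗_k V)^H = finrank_k V^H` whenever moreover `K` is
  a domain and `k → K` is injective (Mathlib `IsBaseChange.finrank_eq`: the rank of a module over a domain
  is the rank of its base change) — e.g. `k = ℤ`, `K = ℚ`, `V` ANY `ℤ[G]`-module (torsion allowed):
  `dim_ℚ (ℚ ⊗ Λ)^H = rk_ℤ Λ^H`.  (For `V` finite free over a field `k` this is the case `W = k` of the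
  tree's `IntertwiningBaseChange.finrank_intertwining_baseChange`; the point here is an arbitrary base
  ring `k` and arbitrary `V`, as needed for unit groups.)
* §2 bookkeeping used with Serre's criterion `dim V^C` (`RationalRepresentationCyclicInvariants`):
  `invariantsProdEquiv` (`(V × W)^H ≃ V^H × W^H` for Mathlib's `Representation.prod`),
  `finrank_invariants_prod`, `invariants_trivial_comp_eq_top`, `finrank_invariants_trivial_self`.

Written for lane «TATE-EPC-TC» of cell `bsd-eis` (brick B7, the equivariant `S`-unit theorem: the
`ℚ[Gal(E/F)]`-module `ℚ ⊗ 𝒪_{E,S}^×` is compared with a permutation module through `dim (·)^C`).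

## References
* [Bourbaki1989CommAlg] N. Bourbaki, *Commutative Algebra*, Ch. I §2 no. 3 (flat modules and exactness),
  no. 10 Prop. 11.
* [SerreLinearRepresentations1977] J.-P. Serre, *Linear Representations of Finite Groups*, §12.1
  (extension of the base field), §13.1 Cor. to Thm. 30.
-/

noncomputable section

namespace Literature.RepresentationTheory

open Representation TensorProduct Module
open Literature.RepresentationTheory.IntertwiningBaseChange (repBaseChange repBaseChange_apply)

universe u v w x y

/-! ## §1 `V^H` as a kernel and its flat base change -/

section BaseChange

variable {k : Type u} [CommRing k] (K : Type v) [CommRing K] [Algebra k K]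
variable {G : Type w} [Group G] {V : Type x} [AddCommGroup V] [Module k V]
variable (ρ : Representation k G V) (H : Subgroup G)

/-- The linear map `Φ : v ↦ (ρ(h) v − v)_{h ∈ H}` whose kernel is the fixed module `V^H`.
[cite: SerreLinearRepresentations1977, §2.6 / §13.1 (the invariants `V^H`)] -/
def invariantsCond : V →ₗ[k] (H → V) :=
  LinearMap.pi fun h : H => ρ h - LinearMap.id

/-- `Φ v h = ρ(h) v − v`. [cite: SerreLinearRepresentations1977, §2.6 (the invariants `V^G`)] -/
@[simp] theorem invariantsCond_apply (v : V) (h : H) : invariantsCond ρ H v h = ρ h v - v := rfl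

/-- **`V^H = ker Φ`**: a vector is fixed by `H` iff all `ρ(h) v − v` vanish.
[cite: SerreLinearRepresentations1977, §2.6 (the invariants `V^G`)] -/
theorem ker_invariantsCond :
    LinearMap.ker (invariantsCond ρ H) = invariants (ρ.comp H.subtype) := by
  ext v
  simp only [LinearMap.mem_ker, mem_invariants, funext_iff, invariantsCond_apply, Pi.zero_apply,
    sub_eq_zero, MonoidHom.coe_comp, Function.comp_apply, Subgroup.coe_subtype, Subtype.forall]

variable [Fintype H] [DecidableEq H]

/-- After extension of scalars the condition map of `ρ_K` is `1 ⊗ Φ` followed by the canonical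
isomorphism `K ⊗ V^H ≅ (K ⊗ V)^H` of a finite product. [cite: SerreLinearRepresentations1977, §12.1 (extension of scalars)] -/
theorem invariantsCond_repBaseChange :
    invariantsCond (repBaseChange K ρ) H =
      (TensorProduct.piRight k K K (fun _ : H => V)).toLinearMap ∘ₗ (invariantsCond ρ H).baseChange K := by
  refine TensorProduct.AlgebraTensorModule.ext fun c v => ?_
  funext h
  simp only [invariantsCond_apply, repBaseChange_apply, LinearMap.baseChange_tmul, LinearMap.coe_comp,
    LinearEquiv.coe_coe, Function.comp_apply, TensorProduct.piRight_apply,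
    TensorProduct.piRightHom_tmul, TensorProduct.tmul_sub]

/-- **`(K ⊗ V)^H = ker (1 ⊗ Φ)`**. [cite: SerreLinearRepresentations1977, §12.1 (extension of scalars)] -/
theorem ker_baseChange_invariantsCond :
    LinearMap.ker ((invariantsCond ρ H).baseChange K) =
      invariants ((repBaseChange K ρ).comp H.subtype) := by
  rw [← ker_invariantsCond, invariantsCond_repBaseChange, LinearMap.ker_comp,
    LinearEquiv.ker, Submodule.comap_bot]

variable [Module.Flat k K]

/-- **Invariants commute with flat base change: `K ⊗_k V^H ≃ (K ⊗_k V)^H`** (`H` finite, `K` flat over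
`k`): the flat functor `K ⊗_k −` carries the exact sequence `0 → V^H → V → V^H` to an exact sequence.
[cite: Bourbaki1989CommAlg, Ch. I §2 no. 3 Prop. 1 (flatness preserves injections and kernels)] -/
def invariantsBaseChangeEquiv :
    K ⊗[k] invariants (ρ.comp H.subtype) ≃ₗ[K] invariants ((repBaseChange K ρ).comp H.subtype) :=
  (LinearEquiv.ofEq _ _ (ker_invariantsCond ρ H).symm).baseChange k K _ _
    ≪≫ₗ (LinearMap.tensorKerEquiv K K (invariantsCond ρ H))
    ≪≫ₗ LinearEquiv.ofEq _ _ (ker_baseChange_invariantsCond K ρ H)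

/-- On pure tensors the isomorphism is `c ⊗ v ↦ c ⊗ v`.
[cite: Bourbaki1989CommAlg, Ch. I §2 no. 3 Prop. 1 (flatness preserves injections and kernels)] -/
theorem invariantsBaseChangeEquiv_tmul (c : K) (v : invariants (ρ.comp H.subtype)) :
    ((invariantsBaseChangeEquiv K ρ H (c ⊗ₜ v) : invariants ((repBaseChange K ρ).comp H.subtype)) :
      K ⊗[k] V) = c ⊗ₜ (v : V) := by
  simp only [invariantsBaseChangeEquiv, LinearEquiv.trans_apply, LinearEquiv.baseChange_tmul,
    LinearEquiv.coe_ofEq_apply, LinearMap.tensorKerEquiv_apply, LinearMap.tensorKer_tmul]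

omit [DecidableEq H] in
/-- **`finrank_K (K ⊗_k V)^H = finrank_k V^H`** for `H` finite, `K` a flat `k`-algebra which is a domain
with `k → K` injective (e.g. `ℤ → ℚ`, any `ℤ[G]`-module `V`): invariants do not grow under extension of
scalars, counted by rank. [cite: Bourbaki1989CommAlg, Ch. I §2 no. 3 Prop. 1 and no. 10 Prop. 11]
[cite: SerreLinearRepresentations1977, §12.1] -/
theorem finrank_invariants_repBaseChange [NoZeroDivisors K] [FaithfulSMul k K] :
    finrank K (invariants ((repBaseChange K ρ).comp H.subtype)) =
      finrank k (invariants (ρ.comp H.subtype)) := by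
  classical
  rw [← (invariantsBaseChangeEquiv K ρ H).finrank_eq]
  exact IsBaseChange.finrank_eq (TensorProduct.isBaseChange k (invariants (ρ.comp H.subtype)) K)

end BaseChange

/-! ## §2 Invariants of a product and of the trivial representation -/

section Prod

variable {k : Type u} [CommRing k] {G : Type w} [Group G]
variable {V : Type x} [AddCommGroup V] [Module k V] {W : Type y} [AddCommGroup W] [Module k W]
variable (ρ : Representation k G V) (σ : Representation k G W) (H : Subgroup G)

/-- Membership in the invariants of `ρ × σ` is componentwise.
[cite: SerreLinearRepresentations1977, §2.6 (invariants of a direct sum)] -/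
theorem mem_invariants_prod_comp_iff (x : V × W) :
    x ∈ invariants ((ρ.prod σ).comp H.subtype) ↔
      x.1 ∈ invariants (ρ.comp H.subtype) ∧ x.2 ∈ invariants (σ.comp H.subtype) := by
  simp only [mem_invariants, MonoidHom.coe_comp, Function.comp_apply, Representation.prod_apply_apply,
    Prod.ext_iff]
  exact ⟨fun h => ⟨fun g => (h g).1, fun g => (h g).2⟩, fun h g => ⟨h.1 g, h.2 g⟩⟩

/-- **`(V × W)^H ≃ V^H × W^H`** for Mathlib's product representation `Representation.prod`.
[cite: SerreLinearRepresentations1977, §2.6 (invariants of a direct sum)] -/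
def invariantsProdEquiv :
    invariants ((ρ.prod σ).comp H.subtype) ≃ₗ[k]
      invariants (ρ.comp H.subtype) × invariants (σ.comp H.subtype) where
  toFun x := (⟨x.1.1, ((mem_invariants_prod_comp_iff ρ σ H x.1).1 x.2).1⟩,
    ⟨x.1.2, ((mem_invariants_prod_comp_iff ρ σ H x.1).1 x.2).2⟩)
  invFun y := ⟨(y.1.1, y.2.1), (mem_invariants_prod_comp_iff ρ σ H _).2 ⟨y.1.2, y.2.2⟩⟩
  map_add' _ _ := rfl
  map_smul' _ _ := rfl
  left_inv _ := rfl
  right_inv _ := rfl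

/-- **`dim (V × W)^H = dim V^H + dim W^H`** (finite-dimensional case). [cite: SerreLinearRepresentations1977, §2.6] -/
theorem finrank_invariants_prod {K : Type u} [Field K] {V' : Type x} [AddCommGroup V'] [Module K V']
    {W' : Type y} [AddCommGroup W'] [Module K W'] [FiniteDimensional K V'] [FiniteDimensional K W']
    (ρ' : Representation K G V') (σ' : Representation K G W') (H : Subgroup G) :
    finrank K (invariants ((ρ'.prod σ').comp H.subtype)) =
      finrank K (invariants (ρ'.comp H.subtype)) + finrank K (invariants (σ'.comp H.subtype)) := by
  rw [(invariantsProdEquiv ρ' σ' H).finrank_eq, Module.finrank_prod]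

/-- The invariants of the trivial representation are everything.
[cite: SerreLinearRepresentations1977, §2.3 (the unit representation; `(χ|1) = dim V^G`)] -/
theorem invariants_trivial_comp_eq_top :
    invariants ((Representation.trivial k G V).comp H.subtype) = ⊤ := by
  rw [eq_top_iff]
  intro v _ g
  simp

variable (k G) in
/-- `dim (k)^H = 1` for the unit representation `1_G` on `k`.
[cite: SerreLinearRepresentations1977, §2.3 (the unit representation; `(χ|1) = dim V^G`)] -/
theorem finrank_invariants_trivial_self [Nontrivial k] :
    finrank k (invariants ((Representation.trivial k G k).comp H.subtype)) = 1 := by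
  rw [invariants_trivial_comp_eq_top, finrank_top, Module.finrank_self]

end Prod

end Literature.RepresentationTheory

end
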